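import Literature.AlgebraicGeometry.Surfaces.HirzebruchTwoNodalDoubleCover
import HarnessLib

/-!
# The chart transforms of `𝔽₂` are multiplicative (chart calculus for the four-chart named fact)

Topic `Literature/AlgebraicGeometry/Surfaces`, namespace `Literature.AlgebraicGeometry.Surfaces.HirzebruchTwoDoublePlane` (sequel of
`HirzebruchTwoNodalDoubleCover`). One auxiliary definition (`monoTrans`, a monomial re-indexing operator) + PROVED lemmas; no named
fact. Written by the prover seat `leafhand-hodge-q8symplecticpowers-4` (g5, cell `pub-hsemireg`) as target (T1) of memo
NINTH-HAND-S1-DESIGN-leafhand4-g5 for the S1 re-cut of route `HodgeConjecture/Q8SymplecticPowers` (crux K1Q, stmt-HodgeConjecture-24190):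
the consumer of the named fact `hirzebruchTwo_nodalDoubleCover_bettiOne_eq_zero` must compute the chart equations
`chartTwo N F`, `chartThree α F`, `chartFour α N F` of a branch curve given as a PRODUCT `F = ∏ Fᵢ` (for the route:
`κ · s(s² − 1) · y · Ψ₂`), and these lemmas reduce that to the factors.

Mathematics (trivial bookkeeping, [Hartshorne1977, V.2: `𝔽₂ = ℙ(𝒪 ⊕ 𝒪(−2))`, transition functions of the ruled surface]): the
three transforms re-index monomials, `sⁱyʲ ↦ s′^{N−i+2j} y′^{j}`, `↦ sⁱ v^{α−j}`, `↦ s′^{N−i+2j} v′^{α−j}`; the re-indexing map of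
`(α₁ + α₂, N₁ + N₂)` is additive on pairs of monomials obeying the support bounds of `(α₁, N₁)` and `(α₂, N₂)` (no truncated
subtraction occurs), so the transforms are multiplicative on such pairs: e.g.
`chartThree (α₁ + α₂) (F * G) = chartThree α₁ F * chartThree α₂ G` whenever `deg_y F ≤ α₁`, `deg_y G ≤ α₂`.
USAGE NOTE for the route: the bound `i ≤ N + 2j` must hold factor by factor with `N ≥ 0`; group `s(s² − 1) · y` (monomials `s³y`,
`sy`: `N = 1`) and take `N = 0` for `Ψ₂` (monomials `(s²y)^a y^b`: `i − 2j = −2b ≤ 0`, constant term present), total `N = 1`.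

## What is here

* `monoTrans φ F = Σ_m coeff_m(F) · X^{φ m}`; `monoTrans_eq_sum_of_subset`, `monoTrans_add`, `monoTrans_monomial`, `monoTrans_sum`, **`monoTrans_mul`** (multiplicative when `φ₃(m + m′) =
  φ₁ m + φ₂ m′` on the supports);
* `chartTwo_eq_monoTrans`, `chartThree_eq_monoTrans`, `chartFour_eq_monoTrans` (definitional), the monomial values
  `chartTwo_monomial`, `chartThree_monomial`, `chartFour_monomial`, additivity `chartTwo_add`, `chartThree_add`, `chartFour_add`;
* **`chartTwo_mul`, `chartThree_mul`, `chartFour_mul`** under the support bounds (`∀ m ∈ F.support, m 1 ≤ α₁` ∕ `m 0 ≤ N₁ + 2·m 1`).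

Honest scope: bookkeeping; nothing here bears on HC, and S1 ∕ K1Q are NOT proved here.

## References
* [Hartshorne1977] R. Hartshorne, *Algebraic Geometry* (1977), V.2 (ruled surfaces; `𝔽ₑ = ℙ(𝒪 ⊕ 𝒪(−e))`).
* [BarthPetersVandeVen1984] W. Barth, C. Peters, A. Van de Ven, *Compact Complex Surfaces* (1984), V §4 (Hirzebruch surfaces).
-/

set_option autoImplicit false

open MvPolynomial

namespace Literature.AlgebraicGeometry.Surfaces.HirzebruchTwoDoublePlane

variable {k : Type*} [CommRing k]

/-! ### A monomial re-indexing operator -/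

/-- Re-index the monomials of `F` along `φ`: `monoTrans φ F = Σ_{m ∈ supp F} coeff_m(F) · X^{φ(m)}`.
[cite: Hartshorne1977, V.2 (transition functions of `ℙ(𝒪 ⊕ 𝒪(−e))`)] -/
noncomputable def monoTrans (φ : (Fin 2 →₀ ℕ) → (Fin 2 →₀ ℕ)) (F : MvPolynomial (Fin 2) k) : MvPolynomial (Fin 2) k :=
  ∑ m ∈ F.support, monomial (φ m) (coeff m F)

/-- `monoTrans φ F` may be computed over any finite set of monomials containing the support.
[cite: Hartshorne1977, V.2 (ruled surfaces)] -/
theorem monoTrans_eq_sum_of_subset (φ : (Fin 2 →₀ ℕ) → (Fin 2 →₀ ℕ)) (F : MvPolynomial (Fin 2) k) {s : Finset (Fin 2 →₀ ℕ)}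
    (hs : F.support ⊆ s) : monoTrans φ F = ∑ m ∈ s, monomial (φ m) (coeff m F) := by
  rw [monoTrans]
  refine Finset.sum_subset hs fun m _ hm => ?_
  rw [notMem_support_iff.1 hm, map_zero]

/-- `monoTrans` is additive. [cite: Hartshorne1977, V.2 (ruled surfaces)] -/
theorem monoTrans_add (φ : (Fin 2 →₀ ℕ) → (Fin 2 →₀ ℕ)) (F G : MvPolynomial (Fin 2) k) :
    monoTrans φ (F + G) = monoTrans φ F + monoTrans φ G := by
  classical
  rw [monoTrans_eq_sum_of_subset φ (F + G) (s := F.support ∪ G.support) support_add,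
    monoTrans_eq_sum_of_subset φ F (s := F.support ∪ G.support) Finset.subset_union_left,
    monoTrans_eq_sum_of_subset φ G (s := F.support ∪ G.support) Finset.subset_union_right, ← Finset.sum_add_distrib]
  refine Finset.sum_congr rfl fun m _ => ?_
  rw [coeff_add, map_add]

/-- `monoTrans` on a monomial. [cite: Hartshorne1977, V.2 (ruled surfaces)] -/
theorem monoTrans_monomial (φ : (Fin 2 →₀ ℕ) → (Fin 2 →₀ ℕ)) (m : Fin 2 →₀ ℕ) (c : k) :
    monoTrans φ (monomial m c) = monomial (φ m) c := by
  classical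
  rw [monoTrans_eq_sum_of_subset φ (monomial m c) (s := {m}) support_monomial_subset, Finset.sum_singleton,
    coeff_monomial, if_pos rfl]

/-- `monoTrans φ 0 = 0`. [cite: Hartshorne1977, V.2 (ruled surfaces)] -/
theorem monoTrans_zero (φ : (Fin 2 →₀ ℕ) → (Fin 2 →₀ ℕ)) : monoTrans φ (0 : MvPolynomial (Fin 2) k) = 0 := by
  rw [monoTrans_eq_sum_of_subset φ 0 (s := ∅) (by rw [support_zero]), Finset.sum_empty]

/-- `monoTrans` of a finite sum. [cite: Hartshorne1977, V.2 (ruled surfaces)] -/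
theorem monoTrans_sum {ι : Type*} (φ : (Fin 2 →₀ ℕ) → (Fin 2 →₀ ℕ)) (s : Finset ι) (F : ι → MvPolynomial (Fin 2) k) :
    monoTrans φ (∑ i ∈ s, F i) = ∑ i ∈ s, monoTrans φ (F i) := by
  classical
  induction s using Finset.induction_on with
  | empty => rw [Finset.sum_empty, Finset.sum_empty, monoTrans_zero]
  | insert a s ha ih => rw [Finset.sum_insert ha, Finset.sum_insert ha, monoTrans_add, ih]

/-- **Multiplicativity of monomial re-indexing**: if `φ₃(m + m′) = φ₁(m) + φ₂(m′)` for all `m ∈ supp F`, `m′ ∈ supp G`, then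
`monoTrans φ₃ (F·G) = monoTrans φ₁ F · monoTrans φ₂ G`. [cite: Hartshorne1977, V.2 (ruled surfaces)] -/
theorem monoTrans_mul (φ₁ φ₂ φ₃ : (Fin 2 →₀ ℕ) → (Fin 2 →₀ ℕ)) (F G : MvPolynomial (Fin 2) k)
    (hφ : ∀ m ∈ F.support, ∀ m' ∈ G.support, φ₃ (m + m') = φ₁ m + φ₂ m') :
    monoTrans φ₃ (F * G) = monoTrans φ₁ F * monoTrans φ₂ G := by
  conv_lhs => rw [F.as_sum, G.as_sum, Finset.sum_mul_sum]
  rw [monoTrans_sum]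
  have h : ∀ m ∈ F.support, monoTrans φ₃ (∑ m' ∈ G.support, monomial m (coeff m F) * monomial m' (coeff m' G)) =
      ∑ m' ∈ G.support, monomial (φ₁ m) (coeff m F) * monomial (φ₂ m') (coeff m' G) := by
    intro m hm
    rw [monoTrans_sum]
    refine Finset.sum_congr rfl fun m' hm' => ?_
    rw [monomial_mul, monoTrans_monomial, hφ m hm m' hm', monomial_mul]
  rw [Finset.sum_congr rfl h, ← Finset.sum_mul_sum]
  rfl

/-! ### The three chart transforms as re-indexings -/

/-- The re-indexing map of chart `U₂`: `(i, j) ↦ (N − i + 2j, j)`. [cite: Hartshorne1977, V.2 (ruled surfaces)] -/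
theorem chartTwo_eq_monoTrans (N : ℕ) (F : MvPolynomial (Fin 2) ℂ) :
    chartTwo N F = monoTrans (fun m => Finsupp.single 0 (N + 2 * m 1 - m 0) + Finsupp.single 1 (m 1)) F := rfl

/-- The re-indexing map of chart `U₃`: `(i, j) ↦ (i, α − j)`. [cite: Hartshorne1977, V.2 (ruled surfaces)] -/
theorem chartThree_eq_monoTrans (α : ℕ) (F : MvPolynomial (Fin 2) ℂ) :
    chartThree α F = monoTrans (fun m => Finsupp.single 0 (m 0) + Finsupp.single 1 (α - m 1)) F := rfl

/-- The re-indexing map of chart `U₄`: `(i, j) ↦ (N − i + 2j, α − j)`. [cite: Hartshorne1977, V.2 (ruled surfaces)] -/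
theorem chartFour_eq_monoTrans (α N : ℕ) (F : MvPolynomial (Fin 2) ℂ) :
    chartFour α N F = monoTrans (fun m => Finsupp.single 0 (N + 2 * m 1 - m 0) + Finsupp.single 1 (α - m 1)) F := rfl

/-- `chartTwo` on a monomial. [cite: Hartshorne1977, V.2 (ruled surfaces)] -/
theorem chartTwo_monomial (N : ℕ) (m : Fin 2 →₀ ℕ) (c : ℂ) :
    chartTwo N (monomial m c) = monomial (Finsupp.single 0 (N + 2 * m 1 - m 0) + Finsupp.single 1 (m 1)) c := by
  rw [chartTwo_eq_monoTrans, monoTrans_monomial]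

/-- `chartThree` on a monomial. [cite: Hartshorne1977, V.2 (ruled surfaces)] -/
theorem chartThree_monomial (α : ℕ) (m : Fin 2 →₀ ℕ) (c : ℂ) :
    chartThree α (monomial m c) = monomial (Finsupp.single 0 (m 0) + Finsupp.single 1 (α - m 1)) c := by
  rw [chartThree_eq_monoTrans, monoTrans_monomial]

/-- `chartFour` on a monomial. [cite: Hartshorne1977, V.2 (ruled surfaces)] -/
theorem chartFour_monomial (α N : ℕ) (m : Fin 2 →₀ ℕ) (c : ℂ) :
    chartFour α N (monomial m c) = monomial (Finsupp.single 0 (N + 2 * m 1 - m 0) + Finsupp.single 1 (α - m 1)) c := by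
  rw [chartFour_eq_monoTrans, monoTrans_monomial]

/-- `chartTwo` is additive. [cite: Hartshorne1977, V.2 (ruled surfaces)] -/
theorem chartTwo_add (N : ℕ) (F G : MvPolynomial (Fin 2) ℂ) : chartTwo N (F + G) = chartTwo N F + chartTwo N G := by
  rw [chartTwo_eq_monoTrans, chartTwo_eq_monoTrans, chartTwo_eq_monoTrans, monoTrans_add]

/-- `chartThree` is additive. [cite: Hartshorne1977, V.2 (ruled surfaces)] -/
theorem chartThree_add (α : ℕ) (F G : MvPolynomial (Fin 2) ℂ) : chartThree α (F + G) = chartThree α F + chartThree α G := by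
  rw [chartThree_eq_monoTrans, chartThree_eq_monoTrans, chartThree_eq_monoTrans, monoTrans_add]

/-- `chartFour` is additive. [cite: Hartshorne1977, V.2 (ruled surfaces)] -/
theorem chartFour_add (α N : ℕ) (F G : MvPolynomial (Fin 2) ℂ) :
    chartFour α N (F + G) = chartFour α N F + chartFour α N G := by
  rw [chartFour_eq_monoTrans, chartFour_eq_monoTrans, chartFour_eq_monoTrans, monoTrans_add]

/-! ### Multiplicativity under the support bounds -/

/-- **`chartThree` is multiplicative**: if `deg_y F ≤ α₁` and `deg_y G ≤ α₂` (support-wise), then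
`chartThree (α₁ + α₂) (F·G) = chartThree α₁ F · chartThree α₂ G` (`v^{α₁+α₂}·(FG)(s, 1/v) = v^{α₁}F(s,1/v) · v^{α₂}G(s,1/v)`).
[cite: Hartshorne1977, V.2 (ruled surfaces)] -/
theorem chartThree_mul {α₁ α₂ : ℕ} {F G : MvPolynomial (Fin 2) ℂ} (hF : ∀ m ∈ F.support, m 1 ≤ α₁)
    (hG : ∀ m ∈ G.support, m 1 ≤ α₂) :
    chartThree (α₁ + α₂) (F * G) = chartThree α₁ F * chartThree α₂ G := by
  rw [chartThree_eq_monoTrans, chartThree_eq_monoTrans, chartThree_eq_monoTrans]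
  refine monoTrans_mul _ _ _ F G fun m hm m' hm' => ?_
  have h1 := hF m hm
  have h2 := hG m' hm'
  ext i
  fin_cases i <;> simp
  omega

/-- **`chartTwo` is multiplicative**: if `i ≤ N₁ + 2j` on `supp F` and `i ≤ N₂ + 2j` on `supp G`, then
`chartTwo (N₁ + N₂) (F·G) = chartTwo N₁ F · chartTwo N₂ G` (`s′^{N₁+N₂}·(FG)(1/s′, y′s′²) = …`). [cite: Hartshorne1977, V.2 (ruled surfaces)] -/
theorem chartTwo_mul {N₁ N₂ : ℕ} {F G : MvPolynomial (Fin 2) ℂ} (hF : ∀ m ∈ F.support, m 0 ≤ N₁ + 2 * m 1)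
    (hG : ∀ m ∈ G.support, m 0 ≤ N₂ + 2 * m 1) :
    chartTwo (N₁ + N₂) (F * G) = chartTwo N₁ F * chartTwo N₂ G := by
  rw [chartTwo_eq_monoTrans, chartTwo_eq_monoTrans, chartTwo_eq_monoTrans]
  refine monoTrans_mul _ _ _ F G fun m hm m' hm' => ?_
  have h1 := hF m hm
  have h2 := hG m' hm'
  ext i
  fin_cases i <;> simp
  omega

/-- **`chartFour` is multiplicative** under both support bounds. [cite: Hartshorne1977, V.2 (ruled surfaces)] -/
theorem chartFour_mul {α₁ α₂ N₁ N₂ : ℕ} {F G : MvPolynomial (Fin 2) ℂ}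
    (hF : ∀ m ∈ F.support, m 1 ≤ α₁ ∧ m 0 ≤ N₁ + 2 * m 1) (hG : ∀ m ∈ G.support, m 1 ≤ α₂ ∧ m 0 ≤ N₂ + 2 * m 1) :
    chartFour (α₁ + α₂) (N₁ + N₂) (F * G) = chartFour α₁ N₁ F * chartFour α₂ N₂ G := by
  rw [chartFour_eq_monoTrans, chartFour_eq_monoTrans, chartFour_eq_monoTrans]
  refine monoTrans_mul _ _ _ F G fun m hm m' hm' => ?_
  obtain ⟨h1, h1'⟩ := hF m hm
  obtain ⟨h2, h2'⟩ := hG m' hm'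
  ext i
  fin_cases i <;> simp <;> omega

end Literature.AlgebraicGeometry.Surfaces.HirzebruchTwoDoublePlane
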